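import Mathlib
import Literature.Analysis.FluidPDE.MaximalEnstrophy
import Literature.Analysis.FluidPDE.LerayEventualRegularityH1
import Literature.Analysis.FluidPDE.LerayLocalRegularH1Proofs
import Literature.Analysis.FluidPDE.LerayHopfNSRescale
import Literature.Analysis.FluidPDE.LerayH1Continuation
import Literature.Analysis.FluidPDE.NSSerrinUniqueness
import Summits.NavierStokesRegularity.NavierStokesRegularity.Theses.ExtremalEnstrophy
import HarnessLib

/-!
# `ExtremalEnstrophy.SmallBudgetMonotone` (item stmt-NavierStokesRegularity-18666), PROVED

**Statement.** For every `ν > 0` there is `κ = κ(ν) > 0` such that `E · Z ≤ κ` implies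
`𝒵_ν(E, Z, T) = maxEnstrophy ν E Z T ≤ Z` for every horizon `T`: from data with small
energy × enstrophy the enstrophy of EVERY Leray–Hopf trajectory never exceeds its initial budget
(Leray 1934, §20 and §34: local regular solutions from `H¹` data with non-increasing enstrophy under
the smallness `‖u₀‖₂‖∇u₀‖₂ ≪ ν²`, plus weak–strong uniqueness; Robinson–Rodrigo–Sadowski 2016,
Lemma 6.13, Thm. 6.15, Thm. 8.1).

PROOF (glue of tree theorems; every input kernel-checked).
1. `exists_leray_window_zero` — the Leray window issued from time `0` (the tree's
   `exists_leray_window` is stated from a good time `σ > 0`; the same proof runs at `σ = 0` where the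
   datum IS the slice `u 0`): Leray's local regular solution from `u 0`
   (`leray_local_regular_H1_holds`), its enstrophy monotonicity under `E₀ a < c₀ν⁴`
   (`exists_const_eWeakGradL2Sq_le_of_regular`) and weak–strong uniqueness in `L^∞_t L⁶_x`
   (`serrin_weak_strong_uniqueness_holds`) give `∫⁻|∇u(t)|² ≤ a` on `[0, min(d, T)]`,
   `a² d ≤ c ν³`.
2. From a good restarting time inside that window (`IsLerayHopfOn.exists_isLerayHopfOn_restart_Ioo`)
   the tree's chained theorem `exists_isH1RegularOn_Icc_of_small_good_time` carries the bound to the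
   whole lifespan, under `(2 KE(u₀) + 1) a < c₀' ν⁴`.
3. The non-scale-invariant `+ 1` is absorbed by the Navier–Stokes scaling
   `u ↦ λ u(λ² ·, λ ·)` (`isLerayHopfOn_nsRescale`; on `ℝ³` energy scales by `λ⁻¹`,
   `kineticEnergy_nsRescaleData`, and enstrophy by `λ`, `eWeakGradL2Sq_nsRescaleData_three`):
   with `λ (Z + δ) = κ := min(c₀, c₀') ν⁴ / 8` the rescaled smallness reads
   `E Z + E δ + κ < 3κ < min(c₀, c₀') ν⁴`, for every small `δ > 0`; letting `δ → 0`
   (`ENNReal.le_of_forall_pos_le_add`) gives `∫⁻|∇u(t)|² ≤ Z`.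

HONEST FRAMING: a classical small-data fact about Leray–Hopf weak solutions (Leray 1934); it says
nothing about large data and nothing here bears on the regularity problem itself.

References: J. Leray, Acta Math. 63 (1934), §20, §34; J. C. Robinson, J. L. Rodrigo, W. Sadowski,
*The Three-Dimensional Navier–Stokes Equations* (CUP 2016), Lemma 6.13, Thm. 6.15, Thm. 8.1.
-/

noncomputable section

set_option linter.dupNamespace false

namespace Summit.NavierStokesRegularity.NavierStokesRegularity.Theorems

open MeasureTheory Set Function Filter Topology
open Literature.Analysis.FluidPDE
open scoped NNReal ENNReal RealInnerProductSpace

namespace SmallBudgetMonotone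

/-- **Leray's window issued from time `0`** (Leray 1934, §20; Robinson–Rodrigo–Sadowski 2016,
Lemma 6.13 with Thm. 6.15 and Thm. 6.10): there are absolute `c, c₀ > 0` such that for a
Leray–Hopf weak solution `u` on `ℝ³ × [0, T)` (`ν, T > 0`) from its own slice `u 0`, with
`∫‖u(t)‖² ≤ E₀` on `[0, T]`, `∫⁻|∇u(0)|² ≤ a`, `E₀ a < c₀ ν⁴`, `0 < d`, `a² d ≤ c ν³`, one has
`∫⁻|∇u(t)|² ≤ a` for every `t ∈ [0, min(d, T)]`. Same proof as the tree's `exists_leray_window`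
(stated there from a good time `σ > 0`), run at `σ = 0`: Leray's local regular solution `V` from
`u 0` (`leray_local_regular_H1_holds`), `u = V` a.e. at positive times by weak–strong uniqueness in
`L^∞_t L⁶_x` (`serrin_weak_strong_uniqueness_holds`), and the monotonicity of the enstrophy of
`V` (`exists_const_eWeakGradL2Sq_le_of_regular`).
[cite: RobinsonRodrigoSadowski2016, Lemma 6.13 and Thm. 6.15; Leray1934, §20] -/
theorem exists_leray_window_zero :
    ∃ c c₀ : ℝ, 0 < c ∧ 0 < c₀ ∧
      ∀ ⦃ν T : ℝ⦄ ⦃u : ℝ → EuclideanSpace ℝ (Fin 3) → EuclideanSpace ℝ (Fin 3)⦄, 0 < ν → 0 < T →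
      IsLerayHopfOn T ν 0 (u 0) u →
      ∀ ⦃E₀ a d : ℝ⦄, 0 < E₀ → (∀ t ∈ Icc 0 T, ∫ x, ‖u t x‖ ^ 2 ≤ E₀) → 0 < a →
        E₀ * a < c₀ * ν ^ 4 → 0 < d → a ^ 2 * d ≤ c * ν ^ 3 →
        eWeakGradL2Sq (u 0) ≤ ENNReal.ofReal a →
        ∀ t ∈ Icc 0 (min d T), eWeakGradL2Sq (u t) ≤ ENNReal.ofReal a := by
  obtain ⟨c, hc, hpack⟩ := leray_local_regular_H1_holds
  obtain ⟨c₀, hc₀, hgrad⟩ := exists_const_eWeakGradL2Sq_le_of_regular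
  refine ⟨c, c₀, hc, hc₀, ?_⟩
  intro ν T u hν hT hLH E₀ a d hE₀ hE ha hsmall hd hdc hg0 t ht
  set d' : ℝ := min d T with hd'def
  have hd' : 0 < d' := lt_min hd hT
  have hd'c : a ^ 2 * d' ≤ c * ν ^ 3 :=
    (mul_le_mul_of_nonneg_left (min_le_left _ _) (sq_nonneg a)).trans hdc
  have hu2 : MemLp (u 0) 2 volume := hLH.memLp 0 ⟨le_rfl, hT.le⟩
  have hdiv : IsWeaklyDivFree (u 0) := hLH.isWeaklyDivFree_datum hT
  obtain ⟨V, P, hV, hV0, hVreg, hVcl, hVpack⟩ := hpack hν hd' hu2 hdiv ha.le hg0 hd'c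
  -- weak–strong uniqueness: `u(τ) = V(τ)` a.e., `0 < τ ≤ d'`
  have hLH' : IsLerayHopfOn d' ν 0 (u 0) u := hLH.of_le (min_le_right _ _)
  have hS : MemLqLp ∞ 6 V (Ioo 0 d') :=
    memLqLp_top_six_of_isH1RegularOn_Icc hVreg fun τ hτ => hV.memLp τ hτ
  have hqr : 2 / (∞ : ℝ≥0∞) + 3 / 6 ≤ 1 := by
    rw [ENNReal.div_top, zero_add]
    exact ENNReal.div_le_of_le_mul (by norm_num)
  have hae : ∀ τ ∈ Ioc 0 d', u τ =ᵐ[volume] V τ :=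
    serrin_weak_strong_uniqueness_holds hν hd' hV hu2 (q := ∞) (r := 6) (by norm_num) hqr hS hLH'
  -- the energy bound along `V`
  have hEV : ∀ τ ∈ Icc 0 d', ∫ x, ‖V τ x‖ ^ 2 ≤ E₀ := by
    intro τ hτ
    have hτT : τ ∈ Icc 0 T := ⟨hτ.1, hτ.2.trans (min_le_right _ _)⟩
    rcases eq_or_lt_of_le hτ.1 with h0 | h0
    · rw [← h0, hV0]; exact hE 0 ⟨le_rfl, hT.le⟩
    · have h1 : (fun x => ‖V τ x‖ ^ 2) =ᵐ[volume] fun x => ‖u τ x‖ ^ 2 := by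
        filter_upwards [hae τ ⟨h0, hτ.2⟩] with x hx
        rw [hx]
      rw [integral_congr_ae h1]
      exact hE τ hτT
  -- the enstrophy bound along `V`, transferred to `u`
  have hgradV : ∀ τ ∈ Icc 0 d', eWeakGradL2Sq (V τ) ≤ ENNReal.ofReal a :=
    hgrad hν hd' hV hV0 hVreg hVcl hVpack hE₀ hEV ha.le hsmall hg0
  rcases eq_or_lt_of_le ht.1 with h0 | h0
  · rw [← h0]; exact hg0
  · rw [eWeakGradL2Sq_congr_ae (hae t ⟨h0, ht.2⟩)]
    exact hgradV t ht

/-- **Small energy × enstrophy: the enstrophy of a Leray–Hopf trajectory never exceeds its initial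
budget, up to `δ`.** With the constants `c, c₀` of `exists_leray_window_zero` and `c₀'` of the
tree's `exists_isH1RegularOn_Icc_of_small_good_time`, put `κ = min(c₀, c₀') ν⁴ / 8`. If `u` is a
Leray–Hopf trajectory on `[0, T')` with `∫⁻‖u 0‖² ≤ E`, `∫⁻|∇(u 0)|² ≤ Z` and `E Z ≤ κ`, then for
every `0 < δ ≤ κ/(E + 1)` and every `t ∈ [0, T')`, `∫⁻|∇u(t)|² ≤ Z + δ`. Proof: rescale by
`λ = κ/(Z + δ)` (`isLerayHopfOn_nsRescale`; energy `× λ⁻¹`, enstrophy `× λ` on `ℝ³`), so that the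
rescaled level is `a = κ` and the rescaled smallness `(2 KE + 1) a ≤ E (Z + δ) + κ < 3κ` holds; the
window from `0` (`exists_leray_window_zero`) and the chain from a good time inside it
(`exists_isH1RegularOn_Icc_of_small_good_time`) bound the rescaled enstrophy by `a` on the whole
rescaled lifespan; scale back. [cite: Leray1934, §20 and §34; RobinsonRodrigoSadowski2016, Thm. 8.1] -/
theorem eWeakGradL2Sq_le_add_of_small {ν : ℝ} (hν : 0 < ν) :
    ∃ κ : ℝ, 0 < κ ∧ ∀ ⦃T' : ℝ⦄ ⦃u : ℝ → EuclideanSpace ℝ (Fin 3) → EuclideanSpace ℝ (Fin 3)⦄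
      ⦃E Z : ℝ⦄, IsLerayHopfTrajectory ν T' u → 0 ≤ E → 0 ≤ Z →
      eEnergy (u 0) ≤ ENNReal.ofReal E → eWeakGradL2Sq (u 0) ≤ ENNReal.ofReal Z → E * Z ≤ κ →
      ∀ ⦃δ : ℝ⦄, 0 < δ → δ * (E + 1) ≤ κ →
      ∀ t ∈ Ico 0 T', eWeakGradL2Sq (u t) ≤ ENNReal.ofReal (Z + δ) := by
  obtain ⟨c, c₀, hc, hc₀, hwin0⟩ := exists_leray_window_zero
  obtain ⟨c₀', hc₀', hchain⟩ := exists_isH1RegularOn_Icc_of_small_good_time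
  set c₁ : ℝ := min c₀ c₀' with hc₁def
  have hc₁ : 0 < c₁ := lt_min hc₀ hc₀'
  have hc₁A : c₁ ≤ c₀ := min_le_left _ _
  have hc₁B : c₁ ≤ c₀' := min_le_right _ _
  set κ : ℝ := c₁ * ν ^ 4 / 8 with hκdef
  have hκ : 0 < κ := by positivity
  refine ⟨κ, hκ, ?_⟩
  intro T' u E Z hu hE0 hZ0 hE hZ hEZ δ hδ hδE t ht
  have hT' : 0 < T' := hu.pos
  have hLH : IsLerayHopfOn T' ν 0 (u 0) u := hu.lerayHopf
  -- ## the scale `λ = κ / (Z + δ)` and the rescaled trajectory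
  set a₀ : ℝ := Z + δ with ha₀def
  have ha₀ : 0 < a₀ := by positivity
  set lam : ℝ := κ / a₀ with hlamdef
  have hlam : 0 < lam := div_pos hκ ha₀
  have hlam_a₀ : lam * a₀ = κ := div_mul_cancel₀ κ ha₀.ne'
  set v : ℝ → EuclideanSpace ℝ (Fin 3) → EuclideanSpace ℝ (Fin 3) := nsRescale lam u with hvdef
  set S : ℝ := T' / lam ^ 2 with hSdef
  have hS : 0 < S := by positivity
  have hdat : nsRescaleData lam (u 0) = v 0 := by
    funext x
    rw [hvdef, nsRescale_apply, nsRescaleData_apply, mul_zero]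
  have hLHv : IsLerayHopfOn S ν 0 (v 0) v := by
    have h := isLerayHopfOn_nsRescale hLH hlam
    rwa [nsRescaleForce_zero, hdat] at h
  -- ## the rescaled budgets: energy `≤ E/λ`, enstrophy `≤ λ Z ≤ λ a₀ = κ`
  have hKE : 2 * VectorCalculus.kineticEnergy (u 0) ≤ E := by
    have h1 : eEnergy (u 0) = ENNReal.ofReal (2 * VectorCalculus.kineticEnergy (u 0)) :=
      eEnergy_eq_ofReal _ (hLH.memLp 0 ⟨le_rfl, hT'.le⟩)
    have h2 : ENNReal.ofReal (2 * VectorCalculus.kineticEnergy (u 0)) ≤ ENNReal.ofReal E := by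
      rw [← h1]; exact hE
    exact (ENNReal.ofReal_le_ofReal_iff hE0).1 h2
  have hKEv : VectorCalculus.kineticEnergy (v 0) = lam⁻¹ * VectorCalculus.kineticEnergy (u 0) := by
    rw [← hdat, kineticEnergy_nsRescaleData hlam, finrank_euclideanSpace_fin]
    congr 1
    field_simp
  have hgrad_v0 : eWeakGradL2Sq (v 0) ≤ ENNReal.ofReal κ := by
    rw [← hdat, eWeakGradL2Sq_nsRescaleData_three hlam, ← hlam_a₀,
      ENNReal.ofReal_mul hlam.le]
    refine mul_le_mul' le_rfl (hZ.trans (ENNReal.ofReal_le_ofReal ?_))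
    rw [ha₀def]; linarith
  -- ## the energy inequality along `v`: `∫‖v(τ)‖² ≤ 2 KE(v 0) < E₀ := 2 KE(v 0) + 1`
  set E₀ : ℝ := 2 * VectorCalculus.kineticEnergy (v 0) + 1 with hE₀def
  have hKEv0 : 0 ≤ VectorCalculus.kineticEnergy (v 0) := kineticEnergy_nonneg _
  have hE₀ : 0 < E₀ := by rw [hE₀def]; linarith
  have hEv : ∀ τ ∈ Icc 0 S, ∫ x, ‖v τ x‖ ^ 2 ≤ E₀ := by
    obtain ⟨G, -, h0⟩ := hLHv.energy_ineq_zero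
    intro τ hτ
    have h1 := h0 τ hτ
    have hforce : ∫ σ in (0 : ℝ)..τ, ∫ x,
        ⟪(0 : ℝ → EuclideanSpace ℝ (Fin 3) → EuclideanSpace ℝ (Fin 3)) σ x, v σ x⟫ = 0 := by
      simp
    rw [hforce, add_zero] at h1
    have h2 : 0 ≤ ν * (∫⁻ σ in Ioo 0 τ, ∫⁻ x, ENNReal.ofReal (frobeniusNormSq (G σ x))).toReal :=
      mul_nonneg hν.le ENNReal.toReal_nonneg
    have h3 : ∫ x, ‖v τ x‖ ^ 2 = 2 * VectorCalculus.kineticEnergy (v τ) := by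
      rw [VectorCalculus.kineticEnergy, ← mul_assoc, mul_inv_cancel₀ two_ne_zero, one_mul]
    rw [h3, hE₀def]
    linarith
  -- ## the smallness `E₀ κ < c₁ ν⁴` (`E₀ κ ≤ E a₀ + κ = E Z + E δ + κ < 3 κ`)
  have hsmall : E₀ * κ < c₁ * ν ^ 4 := by
    have h1 : E₀ ≤ E / lam + 1 := by
      rw [hE₀def, hKEv, div_eq_inv_mul]
      have := mul_le_mul_of_nonneg_left hKE (inv_nonneg.2 hlam.le)
      linarith
    have h2 : E / lam = E * a₀ / κ := by
      rw [hlamdef]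
      field_simp
    have h3 : E₀ * κ ≤ E * a₀ + κ := by
      have h4 : (E / lam + 1) * κ = E * a₀ + κ := by
        rw [h2]; field_simp
      calc E₀ * κ ≤ (E / lam + 1) * κ := mul_le_mul_of_nonneg_right h1 hκ.le
        _ = E * a₀ + κ := h4
    have h5 : E * a₀ = E * Z + δ * E := by rw [ha₀def]; ring
    have h6 : δ * E ≤ κ := by nlinarith
    have h7 : E₀ * κ ≤ 3 * κ := by linarith
    have h8 : 3 * κ < c₁ * ν ^ 4 := by
      rw [hκdef]
      have : 0 < c₁ * ν ^ 4 := by positivity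
      linarith
    exact lt_of_le_of_lt h7 h8
  have hsmallA : E₀ * κ < c₀ * ν ^ 4 :=
    lt_of_lt_of_le hsmall (mul_le_mul_of_nonneg_right hc₁A (by positivity))
  have hsmallB : (2 * VectorCalculus.kineticEnergy (v 0) + 1) * κ < c₀' * ν ^ 4 :=
    lt_of_lt_of_le hsmall (mul_le_mul_of_nonneg_right hc₁B (by positivity))
  -- ## the window from `0` and the chain from a good time inside it
  set d : ℝ := c * ν ^ 3 / κ ^ 2 with hddef
  have hd : 0 < d := by positivity
  have hdc : κ ^ 2 * d ≤ c * ν ^ 3 := by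
    rw [hddef, mul_div_cancel₀ _ (by positivity : κ ^ 2 ≠ 0)]
  have hwin : ∀ τ ∈ Icc 0 (min d S), eWeakGradL2Sq (v τ) ≤ ENNReal.ofReal κ :=
    hwin0 hν hS hLHv hE₀ hEv hκ hsmallA hd hdc hgrad_v0
  have hdS : 0 < min d S := lt_min hd hS
  obtain ⟨s, hsI, hLHs⟩ := hLHv.exists_isLerayHopfOn_restart_Ioo hν.le le_rfl hdS (min_le_right d S)
  have hs : s ∈ Ioo 0 S := ⟨hsI.1, hsI.2.trans_le (min_le_right d S)⟩
  have hgs : eWeakGradL2Sq (v s) ≤ ENNReal.ofReal κ := hwin s ⟨hsI.1.le, hsI.2.le⟩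
  obtain ⟨-, hchain'⟩ := hchain hν hLHv hs hLHs hκ hsmallB hgs
  have hall : ∀ τ ∈ Ico 0 S, eWeakGradL2Sq (v τ) ≤ ENNReal.ofReal κ := by
    intro τ hτ
    by_cases hτs : τ ≤ s
    · exact hwin τ ⟨hτ.1, hτs.trans hsI.2.le⟩
    · exact hchain' τ ⟨(not_le.1 hτs).le, hτ.2.le⟩
  -- ## the rescaled observation time `τ₀ = t / λ²` and the way back
  set τ₀ : ℝ := t / lam ^ 2 with hτ₀def
  have hlam2 : 0 < lam ^ 2 := by positivity
  have hτ₀ : τ₀ ∈ Ico 0 S :=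
    ⟨div_nonneg ht.1 hlam2.le, div_lt_div_of_pos_right ht.2 hlam2⟩
  have hτt : lam ^ 2 * τ₀ = t := mul_div_cancel₀ t hlam2.ne'
  have hslice : v τ₀ = nsRescaleData lam (u t) := by
    funext x
    rw [hvdef, nsRescale_apply, nsRescaleData_apply, hτt]
  have hkey : ENNReal.ofReal lam * eWeakGradL2Sq (u t) ≤ ENNReal.ofReal lam * ENNReal.ofReal a₀ := by
    rw [← eWeakGradL2Sq_nsRescaleData_three hlam, ← hslice, ← ENNReal.ofReal_mul hlam.le, hlam_a₀]
    exact hall τ₀ hτ₀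
  exact (ENNReal.mul_le_mul_iff_right (ENNReal.ofReal_pos.2 hlam).ne' ENNReal.ofReal_ne_top).1 hkey

end SmallBudgetMonotone

open SmallBudgetMonotone in
/-- **Item stmt-NavierStokesRegularity-18666** (`ExtremalEnstrophy.SmallBudgetMonotone`, S1 of the
route): for every `ν > 0` there is `κ > 0` with `maxEnstrophy ν E Z T ≤ Z` whenever `E Z ≤ κ` —
the supremum defining `𝒵` is over Leray–Hopf trajectories within budget, each of which obeys
`∫⁻|∇u(t)|² ≤ Z + δ` for all small `δ > 0` (`eWeakGradL2Sq_le_add_of_small`), hence `≤ Z`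
(`ENNReal.le_of_forall_pos_le_add`). [cite: Leray1934, §20 and §34; RobinsonRodrigoSadowski2016, Lemma 6.13 and Thm. 8.1] -/
theorem extremalEnstrophy_smallBudgetMonotone_proof :
    Summit.NavierStokesRegularity.NavierStokesRegularity.Theses.ExtremalEnstrophy.SmallBudgetMonotone := by
  unfold Summit.NavierStokesRegularity.NavierStokesRegularity.Theses.ExtremalEnstrophy.SmallBudgetMonotone
  intro ν hν
  obtain ⟨κ, hκ, hmain⟩ := eWeakGradL2Sq_le_add_of_small hν
  refine ⟨κ.toNNReal, Real.toNNReal_pos.2 hκ, fun E Z T hEZ => ?_⟩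
  have hEZ' : (E : ℝ) * Z ≤ κ := by
    have h := NNReal.coe_le_coe.2 hEZ
    rwa [NNReal.coe_mul, Real.coe_toNNReal _ hκ.le] at h
  refine sSup_le ?_
  rintro z ⟨T', u, t, hu, hE, hZ, h0t, -, htT', rfl⟩
  have hE' : eEnergy (u 0) ≤ ENNReal.ofReal (E : ℝ) := by rwa [ENNReal.ofReal_coe_nnreal]
  have hZ' : eWeakGradL2Sq (u 0) ≤ ENNReal.ofReal (Z : ℝ) := by rwa [ENNReal.ofReal_coe_nnreal]
  refine ENNReal.le_of_forall_pos_le_add fun ε hε _ => ?_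
  -- `δ = min ε (κ / (E + 1))`
  set δ : ℝ := min (ε : ℝ) (κ / ((E : ℝ) + 1)) with hδdef
  have hE1 : 0 < (E : ℝ) + 1 := by positivity
  have hδ : 0 < δ := lt_min (by exact_mod_cast hε) (div_pos hκ hE1)
  have hδE : δ * ((E : ℝ) + 1) ≤ κ := by
    have h1 : δ ≤ κ / ((E : ℝ) + 1) := min_le_right _ _
    rwa [le_div_iff₀ hE1] at h1
  have h := hmain hu E.coe_nonneg Z.coe_nonneg hE' hZ' hEZ' hδ hδE t ⟨h0t, htT'⟩
  refine h.trans ?_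
  rw [ENNReal.ofReal_add Z.coe_nonneg hδ.le, ENNReal.ofReal_coe_nnreal]
  refine add_le_add le_rfl ?_
  calc ENNReal.ofReal δ ≤ ENNReal.ofReal (ε : ℝ) := ENNReal.ofReal_le_ofReal (min_le_left _ _)
    _ = ε := ENNReal.ofReal_coe_nnreal

end Summit.NavierStokesRegularity.NavierStokesRegularity.Theorems

end
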